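import Summits.ABC.IUTFork.Cor312ProvKIdeles
import Literature.IUT.HodgeTheaters.InitialThetaDataSplitProofs
import Literature.IUT.LogVolume.RescaledCompletionInvariants
import Literature.IUT.LogVolume.DifferentConductorTower
import Literature.NumberTheory.GaloisRepresentations.AdicCompletionUniformizer
import HarnessLib

/-!
# [IUTchI] Ex. 3.2 (iv) at the `K`-level pilot datum: ROOT-PINNED realising q-ideles EXIST —
# `t_q(x₀) = q̲_w`, a `2l`-th root of the Tate parameter `q_w` of `E_K` at every bad fibre point `x₀ ∣ p`

PROOF-ONLY companion (no `def`, no `Prop` fact) of `Cor312ProvKIdeles.lean` (abc-iut-C-cert-3, p434704), written by the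
abc-iut R-H numerics/kernel-eval seat abc-iut-H-num-1 (gen 2) for the R-H sub-cell's SEMANTICS FINDING of 2026-08-26
(H-num-1 g1 19:06:26Z (iii); rh-lead ruling 19:09:10Z «GAP-LEDGER wanted input»). TAKES NO SIDE on [IUTchIII] Cor. 3.12
or on any author: classical valuation bookkeeping on OUR typed objects.

THE POINT. `Cor312Prov.exists_realising_qIdeles_pilotDataOfK` (Cor312ProvKIdeles.lean) gives q-ideles `t_q` of the
`K`-level pilot datum `X := pilotDataOfK D K` with a NORM-ONLY specification: `t_q ≠ 0`, `‖t_q‖ = 1` off `S`, and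
`log ‖t_q(x₀)‖ = −P_q(w)·ln N(w)/n_w` (Dupuy–Hilado (3.4)) — any element of the right norm will do, and the tree's
certificates read the Cor. 3.12 setting `Thm311.Real.settingPrVolSharp X … t_q …` at the CHOSEN one
(`(exists_realising_qIdeles_pilotDataOfK D).choose`). But [IUTchI] Ex. 3.2 (iv) p. 71 fixes `q̲_v := q_v^{1/2l}`, a
`2l`-th ROOT of the Tate parameter — an ELEMENT, not a norm class — and element-level statements at a bad place
(membership of `p*·q̲^{1−j²}` in the log-shell `(p*)⁻¹·log_p 𝒪^×_{K_w}`, the R-H cell «I06⋆») are NOT decided by the norm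
alone (abc-iut-rp-d4, `Literature.IUT.LogVolume.ValuationProfile.not_exists_decision_of_norm`, p468714). THIS file
supplies the root-pinned existence, so that the SAME `settingPrVolSharp`, instantiated at these ideles, is the
«root-pinned bed» of the R-H bookkeeping — with no new definition (consumers `.choose` as before):

* `log_norm_rescaledCompletion_of` — the bridge abc-iut-H-num-1 g1 asked for: for `r ≠ 0` in Mathlib's completion
  `K_w = w.adicCompletion K`, the RESCALED norm of abc-iut-S7's `RescaledCompletion K p w` (the carrier `kOf X p x₀` of
  the real signature, `‖·‖ = ‖·‖_w^{1/n_w}`) satisfies `log ‖of r‖ = log(v_w r)·(ln p)/e(w|p)` (`Ultrametric.AdicCompletion.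
  norm_eq_absNorm_zpow`, `RescaledCompletion.norm_of`, `N(w) = p^{f(w|p)}`, `n_w = e·f`).
* **`exists_rootPinned_realising_qIdeles_pilotDataOfK`** — for every initial Θ-datum `D` there are q-ideles `t_q` of
  `pilotDataOfK D K` with the THREE side conditions of `exists_realising_qIdeles_pilotDataOfK` AND, at every fibre point
  `x₀ ∣ p` whose place `w = placeOf X p x₀` is bad (`w ∈ X.S`): `t_q(x₀)^{2l} = of(q_w)` for a `q_w ∈ K_w` with
  `q_w ≠ 0`, `‖q_w‖ < 1`, `tateJ q_w = j(E_K)` — THE Tate parameter of `E_K ⊗ K_w` (unique: Silverman ATAEC Lemma V.5.1,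
  the tree's `tateParameter_unique`). The root is abc-iut-L5-d209 / L5-t12's
  `InitialThetaData.exists_pow_two_mul_l_eq_tateParameter_of_mem_VFbad` ([IUTchI] Def. 3.1 (b)(c) ⇒ split multiplicative
  reduction with full `2l`-torsion ⇒ `q_w = r^{2l}`); its realising norm is READ OFF the same theorem's valuation clause
  `v_w(j_E) = (v_w r)⁻¹^{2l}`: `ord_w(q) := −ord_w(j_E) = −2l·log v_w(r)`, so `log ‖of r‖ = −(ord_w(q)/2l)·(ln p)/e_w
  = −P_q(w)·ln N(w)/n_w`. Off `S`: `t_q := 1`.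
* `realising_thetaIdeles_of_qIdeles` / **`exists_rootPinned_realising_ideles_pilotDataOfK`** — the Θ-twin: for ANY
  q-ideles with the three side conditions, `t_{Θ,i} := t_q^{(i+1)²}` are Θ-ideles with THEIR three side conditions
  (`P_{Θ,i} = (i+1)²·P_q`, `PilotData.thetaPilot_apply_of_mem`); hence root-pinned pairs `(t_q, t_Θ = t_q^{j²})` exist —
  the idele form of «`q̲_v̲` and `q̲_v̲^{j²}`» ([IUTchII] intro p. 2, the Gaussian monoid `{q̲^{j²}}_j`).

HYPOTHESIS COST, stated: the Tate-parameter identification carries `[IsScalarTower F K F̄]` (abc-iut-L5-t12's section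
variable; true for the genuine data, where `F̄ ⊇ K ⊇ F` is one tower), which `exists_realising_qIdeles_pilotDataOfK` does
not need. Deliberately NOT here: any evaluation of the R-H cell at the root-pinned bed (abc-iut-rp-x3 / rp-d2 / rh2 seats),
any definition, any judgement. typed ≠ proved; instantiated ≠ endorsed.
[cite: Mochizuki2012, IUTchI Def. 3.1 (b),(c) p. 61, Ex. 3.2 (iv) p. 71] [cite: DupuyHilado2025, §3.3, §3.4]
[cite: SilvermanATAEC1994, Lemma V.5.1, Thm. V.5.3] [cite: NeukirchANT1999, Ch. II Prop. (6.8)]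
-/

noncomputable section

open Set Function NumberField IsDedekindDomain

namespace Summit.ABC.IUTFork.Cor312Prov

open Literature.IUT.LogVolume Literature.IUT.HodgeTheaters Thm311.Real Literature.NumberTheory.NumberFields
open Literature.NumberTheory.EllipticCurves

/-! ## §1. The bridge `kOf ↔ adicCompletion`: the rescaled norm of an element of Mathlib's completion, from its valuation -/

section Bridge

variable (K : Type) [Field K] [NumberField K] (p : ℕ) [Fact p.Prime] (w : HeightOneSpectrum (𝓞 K))
  (hw : ((p : ℕ) : 𝓞 K) ∈ w.asIdeal)

/-- **`log ‖of r‖ = log(v_w r)·(ln p)/e(w|p)`** for `r ≠ 0` in `K_w`: Mathlib's norm is `‖r‖_w = N(w)^{log v_w(r)}`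
(`Ultrametric.AdicCompletion.norm_eq_absNorm_zpow`), abc-iut-S7's rescaled norm is `‖r‖_w^{1/n_w}` (`RescaledCompletion.norm_of`),
`N(w) = p^{f(w|p)}` and `n_w = e(w|p)·f(w|p)`. (Here `log v_w(r) = WithZero.log (Valued.v r) = −ord_w(r)`.)
[cite: NeukirchANT1999, Ch. II Prop. (6.8)] -/
theorem log_norm_rescaledCompletion_of (r : w.adicCompletion K) (hr : r ≠ 0) :
    Real.log ‖RescaledCompletion.of K p w hw r‖ =
      ((WithZero.log (Valued.v r) : ℤ) : ℝ) * Real.log p / (w.asIdeal.ramificationIdx ℤ : ℝ) := by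
  set m : ℤ := WithZero.log (Valued.v r) with hm
  have hv0 : Valued.v r ≠ 0 := (Valuation.ne_zero_iff _).mpr hr
  have hvr : Valued.v r = ((Multiplicative.ofAdd m : Multiplicative ℤ) : WithZero (Multiplicative ℤ)) := by
    rw [← WithZero.exp_eq_coe_ofAdd, hm, WithZero.exp_log hv0]
  have hnorm : ‖r‖ = ((Ideal.absNorm w.asIdeal : ℕ) : ℝ) ^ m :=
    Literature.NumberTheory.GaloisRepresentations.Ultrametric.AdicCompletion.norm_eq_absNorm_zpow K w m hvr
  have hp : (0 : ℝ) < p := by exact_mod_cast (Fact.out : p.Prime).pos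
  have he : (w.asIdeal.ramificationIdx ℤ : ℝ) ≠ 0 := by exact_mod_cast (Ideal.ramificationIdx_pos _ _).ne'
  have hf : (w.asIdeal.inertiaDeg ℤ : ℝ) ≠ 0 := by exact_mod_cast (Ideal.inertiaDeg_pos _ _).ne'
  rw [RescaledCompletion.norm_of, hnorm, absNorm_eq_pow_inertiaDeg K p w hw, localDeg]
  push_cast
  rw [← Real.rpow_natCast, ← Real.rpow_intCast, ← Real.rpow_mul hp.le, ← Real.rpow_mul hp.le, Real.log_rpow hp]
  field_simp

end Bridge

/-! ## §2. Root-pinned realising q-ideles of `pilotDataOfK D K` -/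

section RootPinned

variable {F K Fbar : Type} [Field F] [NumberField F] [Field K] [NumberField K] [Algebra F K] [Field Fbar]
  [Algebra F Fbar] [Algebra K Fbar] [IsScalarTower F K Fbar] {E : WeierstrassCurve F} [E.IsElliptic] {l : ℕ}
  {Pb : BadPlacePredicates K} (D : InitialThetaData F K Fbar E l Pb)

omit [IsScalarTower F K Fbar] in
/-- **At a bad place `w` of `K` (over `𝕍(F)^bad`), a `2l`-th root `r ∈ K_w` of the Tate parameter REALISES `P_q(w)` in the
rescaled norm**: if `v_w(j(E_K)) = (v_w r)⁻¹^{2l}` (the valuation clause of abc-iut-L5-t12's Ex. 3.2 (iv) theorem) then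
`log ‖of r‖ = −P_q(w)·ln N(w)/n_w` for `X = pilotDataOfK D K` (`P_q(w) = ord_w(q)/(2l)`, `ord_w(q) := −ord_w(j_E) = −2l·log v_w(r)`).
[cite: DupuyHilado2025, §3.3, §3.4] [cite: Mochizuki2012, IUTchI Ex. 3.2 (iv) p. 71] -/
theorem log_norm_of_root_eq_qPilot (p : ℕ) [Fact p.Prime] (w : HeightOneSpectrum (𝓞 K))
    (hwp : ((p : ℕ) : 𝓞 K) ∈ w.asIdeal) (hwS : w ∈ (pilotDataOfK D K).S) (r : w.adicCompletion K)
    (hval : Valued.v (algebraMap K (w.adicCompletion K) (E.baseChange K).j) = ((Valued.v r)⁻¹) ^ (2 * l)) :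
    Real.log ‖RescaledCompletion.of K p w hwp r‖ =
      -((pilotDataOfK D K).qPilot w) * logNorm K w / localDegree K w := by
  -- `r ≠ 0`: otherwise `v_w(j_E) = 0⁻¹^{2l} = 0`, but `j_E ≠ 0` at a bad place (`ord_w(j_E) < 0`)
  have hl0 : 2 * l ≠ 0 := Nat.mul_ne_zero two_ne_zero (lt_of_lt_of_le (by norm_num) D.five_le_l).ne'
  have hjK : (E.baseChange K).j = algebraMap F K E.j := E.map_j (algebraMap F K)
  have hjval : w.valuation K (algebraMap F K E.j) = ((Valued.v r)⁻¹) ^ (2 * l) := by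
    rw [← IsDedekindDomain.HeightOneSpectrum.valuedAdicCompletion_eq_valuation', ← hjK]
    exact hval
  have hjne : algebraMap F K E.j ≠ 0 := by
    intro h0
    have h := (pilotDataOfK D K).ord_jE_neg w hwS
    rw [show (pilotDataOfK D K).jE = algebraMap F K E.j from rfl, h0] at h
    simp [ord] at h
  have hr : r ≠ 0 := by
    intro h0
    rw [h0, map_zero, inv_zero, zero_pow hl0] at hjval
    exact hjne ((Valuation.zero_iff _).mp hjval)
  have hv0 : Valued.v r ≠ 0 := (Valuation.ne_zero_iff _).mpr hr
  -- `ord_w(q) = −ord_w(j_E) = −2l · log v_w(r)`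
  have hordq : ((pilotDataOfK D K).ordq w : ℝ) = -(2 * l) * ((WithZero.log (Valued.v r) : ℤ) : ℝ) := by
    have h1 : (pilotDataOfK D K).ordq w = WithZero.log (w.valuation K (algebraMap F K E.j)) := by
      unfold PilotData.ordq ord
      rw [show (pilotDataOfK D K).jE = algebraMap F K E.j from rfl, neg_neg]
    rw [h1, hjval, WithZero.log_pow, WithZero.log_inv, nsmul_eq_mul]
    push_cast
    ring
  -- assemble
  have hres : residueChar K w = p := residueChar_eq_of_natCast_mem p hwp
  have he : (ramIdx K w : ℝ) ≠ 0 := by exact_mod_cast ramIdx_ne_zero K w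
  have hf : (resDeg K w : ℝ) ≠ 0 := by exact_mod_cast resDeg_ne_zero K w
  have hl : (l : ℝ) ≠ 0 := by exact_mod_cast (lt_of_lt_of_le (by norm_num) D.five_le_l).ne'
  rw [log_norm_rescaledCompletion_of K p w hwp r hr, (pilotDataOfK D K).qPilot_apply_of_mem hwS, pilotDataOfK_l,
    hordq, logNorm_eq, localDegree, hres, ← ramIdx_eq K w]
  push_cast
  field_simp

/-- **ROOT-PINNED realising q-ideles EXIST for the `K`-level pilot datum of every initial Θ-datum.** There are q-ideles
`t_q` of `X = pilotDataOfK D K` with the three side conditions of `exists_realising_qIdeles_pilotDataOfK` (`t_q ≠ 0`;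
`‖t_q‖ = 1` off `S`; `log ‖t_q(x₀)‖ = −P_q(w)·ln N(w)/n_w`) such that, at every fibre point `x₀ ∣ p` whose place
`w = placeOf X p x₀` is BAD, `t_q(x₀)` is a `2l`-th root of THE Tate parameter `q_w` of `E_K ⊗ K_w` (`q_w ≠ 0`, `‖q_w‖ < 1`,
`tateJ q_w = j(E_K)`; read in Mathlib's `K_w` through abc-iut-S7's identification `RescaledCompletion.of`: `t_q(x₀)^{2l} = of q_w`;
such `q_w` is UNIQUE — Silverman ATAEC Lemma V.5.1, the tree's `tateParameter_unique` — hence equal to abc-iut-L5-t2's named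
`InitialThetaData.tateParamAt` wherever that is in scope). This is
[IUTchI] Ex. 3.2 (iv)'s `q̲_v̲ := q_v̲^{1/2l} ∈ 𝒪^▷_{K_v̲}` as an idele of the Dupuy–Hilado signature: instantiating
`Thm311.Real.settingPrVolSharp X … t_q …` at `.choose` of THIS theorem is the ROOT-PINNED Cor. 3.12 setting.
[cite: Mochizuki2012, IUTchI Def. 3.1 (b),(c) p. 61, Ex. 3.2 (iv) p. 71] [cite: DupuyHilado2025, §3.4]
[cite: SilvermanATAEC1994, Thm. V.5.3] -/
theorem exists_rootPinned_realising_qIdeles_pilotDataOfK :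
    ∃ tq : ∀ (pp : Nat.Primes) (x : (thetaIndex (pilotDataOfK D K)).Fibre (.inr pp)),
        haveI : Fact (pp : ℕ).Prime := ⟨pp.2⟩; kOf (pilotDataOfK D K) pp.1 x,
      (∀ pp x, tq pp x ≠ 0) ∧
      (∀ (pp : Nat.Primes) (x : (thetaIndex (pilotDataOfK D K)).Fibre (.inr pp)),
          haveI : Fact (pp : ℕ).Prime := ⟨pp.2⟩; placeOf (pilotDataOfK D K) pp.1 x ∉ (pilotDataOfK D K).S → ‖tq pp x‖ = 1) ∧
      (∀ (pp : Nat.Primes) (x : (thetaIndex (pilotDataOfK D K)).Fibre (.inr pp)),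
          haveI : Fact (pp : ℕ).Prime := ⟨pp.2⟩
          Real.log ‖tq pp x‖ = -((pilotDataOfK D K).qPilot (placeOf (pilotDataOfK D K) pp.1 x)) *
            logNorm K (placeOf (pilotDataOfK D K) pp.1 x) / localDegree K (placeOf (pilotDataOfK D K) pp.1 x)) ∧
      (∀ (pp : Nat.Primes) (x : (thetaIndex (pilotDataOfK D K)).Fibre (.inr pp)),
          haveI : Fact (pp : ℕ).Prime := ⟨pp.2⟩
          placeOf (pilotDataOfK D K) pp.1 x ∈ (pilotDataOfK D K).S →
            ∃ q : (placeOf (pilotDataOfK D K) pp.1 x).adicCompletion K,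
              q ≠ 0 ∧ ‖q‖ < 1 ∧
              tateJ q = algebraMap K ((placeOf (pilotDataOfK D K) pp.1 x).adicCompletion K) (E.baseChange K).j ∧
              tq pp x ^ (2 * l) =
                RescaledCompletion.of K pp.1 (placeOf (pilotDataOfK D K) pp.1 x)
                  (natCast_mem_placeOf (pilotDataOfK D K) pp.1 x) q) := by
  classical
  have key : ∀ (pp : Nat.Primes) (x : (thetaIndex (pilotDataOfK D K)).Fibre (.inr pp)),
      ∃ a : (haveI : Fact (pp : ℕ).Prime := ⟨pp.2⟩; kOf (pilotDataOfK D K) pp.1 x),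
        a ≠ 0 ∧
        (haveI : Fact (pp : ℕ).Prime := ⟨pp.2⟩
         placeOf (pilotDataOfK D K) pp.1 x ∉ (pilotDataOfK D K).S → ‖a‖ = 1) ∧
        (haveI : Fact (pp : ℕ).Prime := ⟨pp.2⟩
         Real.log ‖a‖ = -((pilotDataOfK D K).qPilot (placeOf (pilotDataOfK D K) pp.1 x)) *
            logNorm K (placeOf (pilotDataOfK D K) pp.1 x) / localDegree K (placeOf (pilotDataOfK D K) pp.1 x)) ∧
        (haveI : Fact (pp : ℕ).Prime := ⟨pp.2⟩
         placeOf (pilotDataOfK D K) pp.1 x ∈ (pilotDataOfK D K).S →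
            ∃ q : (placeOf (pilotDataOfK D K) pp.1 x).adicCompletion K,
              q ≠ 0 ∧ ‖q‖ < 1 ∧
              tateJ q = algebraMap K ((placeOf (pilotDataOfK D K) pp.1 x).adicCompletion K) (E.baseChange K).j ∧
              a ^ (2 * l) =
                RescaledCompletion.of K pp.1 (placeOf (pilotDataOfK D K) pp.1 x)
                  (natCast_mem_placeOf (pilotDataOfK D K) pp.1 x) q) := by
    intro pp x
    haveI : Fact (pp : ℕ).Prime := ⟨pp.2⟩
    set w := placeOf (pilotDataOfK D K) pp.1 x with hwdef
    have hwp : ((pp : ℕ) : 𝓞 K) ∈ w.asIdeal := natCast_mem_placeOf (pilotDataOfK D K) pp.1 x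
    by_cases hS : w ∈ (pilotDataOfK D K).S
    · -- bad place: take the `2l`-th root of the Tate parameter
      have hv : FinitePlace.mk (finBelow F K w) ∈ D.VFbad := (mem_pilotDataOfK_S_iff D K w).mp hS
      haveI : w.asIdeal.LiesOver (FinitePlace.mk (finBelow F K w)).maximalIdeal.asIdeal := by
        rw [FinitePlace.maximalIdeal_mk]
        exact liesOver_finBelow F K w
      obtain ⟨q, r, hq0, hq1, hj, hr, hval⟩ := D.exists_pow_two_mul_l_eq_tateParameter_of_mem_VFbad hv w
      have hr0 : r ≠ 0 := by
        intro h0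
        have hl0 : 2 * l ≠ 0 := Nat.mul_ne_zero two_ne_zero (lt_of_lt_of_le (by norm_num) D.five_le_l).ne'
        rw [h0, zero_pow hl0] at hr
        exact hq0 hr.symm
      refine ⟨RescaledCompletion.of K pp.1 w hwp r, (map_ne_zero _).mpr hr0, fun h => absurd hS h, ?_, fun _ => ?_⟩
      · exact log_norm_of_root_eq_qPilot D pp.1 w hwp hS r hval
      · refine ⟨q, hq0, hq1, hj, ?_⟩
        rw [← map_pow, hr]
    · -- good place: `t_q := 1`
      refine ⟨1, one_ne_zero, fun _ => norm_one, ?_, fun h => absurd h hS⟩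
      rw [norm_one, Real.log_one, (pilotDataOfK D K).qPilot_apply_of_not_mem hS, neg_zero, zero_mul, zero_div]
  choose tq h0 h1 h2 h3 using key
  exact ⟨tq, h0, h1, h2, h3⟩

end RootPinned

/-! ## §3. Θ-ideles as the `(i+1)²`-th powers of q-ideles -/

section Theta

variable {L : Type} [Field L] [NumberField L] (X : PilotData L)

/-- **`t_{Θ,i} := t_q^{(i+1)²}` realises `P_Θ` whenever `t_q` realises `P_q`** (`P_{Θ,i} = (i+1)²·P_q`,
`PilotData.thetaPilot_apply_of_mem`): the three side conditions of the Θ-ideles (`≠ 0`, `= 1` in norm off `S`,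
`log ‖t_{Θ,i}‖ = −P_{Θ,i}(w)·ln N(w)/n_w`) from those of the q-ideles. For a ROOT-PINNED `t_q = q̲` this is the idele
`q̲^{j²}` of the Gaussian monoid ([IUTchII] Introduction; Dupuy–Hilado §3.3). [cite: DupuyHilado2025, §3.3, §3.4] -/
theorem realising_thetaIdeles_of_qIdeles
    (tq : ∀ (pp : Nat.Primes) (x : (thetaIndex X).Fibre (.inr pp)), haveI : Fact (pp : ℕ).Prime := ⟨pp.2⟩; kOf X pp.1 x)
    (htq0 : ∀ pp x, tq pp x ≠ 0)
    (htq1 : ∀ (pp : Nat.Primes) (x : (thetaIndex X).Fibre (.inr pp)),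
      haveI : Fact (pp : ℕ).Prime := ⟨pp.2⟩; placeOf X pp.1 x ∉ X.S → ‖tq pp x‖ = 1)
    (htq : ∀ (pp : Nat.Primes) (x : (thetaIndex X).Fibre (.inr pp)),
      haveI : Fact (pp : ℕ).Prime := ⟨pp.2⟩
      Real.log ‖tq pp x‖ = -(X.qPilot (placeOf X pp.1 x)) * logNorm L (placeOf X pp.1 x) / localDegree L (placeOf X pp.1 x)) :
    (∀ (pp : Nat.Primes) (i : Fin X.lstar) (x : (thetaIndex X).Fibre (.inr pp)), tq pp x ^ (((i : ℕ) + 1) ^ 2) ≠ 0) ∧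
    (∀ (pp : Nat.Primes) (i : Fin X.lstar) (x : (thetaIndex X).Fibre (.inr pp)),
        haveI : Fact (pp : ℕ).Prime := ⟨pp.2⟩; placeOf X pp.1 x ∉ X.S → ‖tq pp x ^ (((i : ℕ) + 1) ^ 2)‖ = 1) ∧
    (∀ (pp : Nat.Primes) (i : Fin X.lstar) (x : (thetaIndex X).Fibre (.inr pp)),
        haveI : Fact (pp : ℕ).Prime := ⟨pp.2⟩
        Real.log ‖tq pp x ^ (((i : ℕ) + 1) ^ 2)‖ =
          -(X.thetaPilot i (placeOf X pp.1 x)) * logNorm L (placeOf X pp.1 x) / localDegree L (placeOf X pp.1 x)) := by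
  refine ⟨fun pp i x => pow_ne_zero _ (htq0 pp x), fun pp i x hx => ?_, fun pp i x => ?_⟩
  · haveI : Fact (pp : ℕ).Prime := ⟨pp.2⟩
    rw [norm_pow, htq1 pp x hx, one_pow]
  · haveI : Fact (pp : ℕ).Prime := ⟨pp.2⟩
    rw [norm_pow, Real.log_pow, htq pp x]
    by_cases hS : placeOf X pp.1 x ∈ X.S
    · rw [X.thetaPilot_apply_of_mem i hS, X.qPilot_apply_of_mem hS]
      push_cast
      ring
    · rw [X.thetaPilot_apply_of_not_mem i hS, X.qPilot_apply_of_not_mem hS]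
      simp

end Theta

/-! ## §4. Root-pinned realising PAIRS `(t_q, t_Θ) = (q̲, q̲^{j²})` -/

section Pair

variable {F K Fbar : Type} [Field F] [NumberField F] [Field K] [NumberField K] [Algebra F K] [Field Fbar]
  [Algebra F Fbar] [Algebra K Fbar] [IsScalarTower F K Fbar] {E : WeierstrassCurve F} [E.IsElliptic] {l : ℕ}
  {Pb : BadPlacePredicates K} (D : InitialThetaData F K Fbar E l Pb)

/-- **Root-pinned realising ideles `(t_q, t_Θ)` EXIST for `pilotDataOfK D K`**: `t_q` as in
`exists_rootPinned_realising_qIdeles_pilotDataOfK` (three side conditions + `t_q(x₀)^{2l} = q_w` at bad `x₀`) and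
`t_{Θ,i} = t_q^{(i+1)²}` with the three Θ-side conditions (`≠ 0`, norm `1` off `S`, `log ‖t_{Θ,i}‖ = −P_{Θ,i}·ln N/n`). These are
exactly the binders `tq, t, htq0, htq1 (, ht0, ht1, ht, htq)` of `Thm311.Real.settingPrVolSharp (pilotDataOfK D K) …` and of its
certificates — the ROOT-PINNED bed is that setting at `.choose` of this theorem. [cite: Mochizuki2012, IUTchI Ex. 3.2 (iv) p. 71]
[cite: DupuyHilado2025, §3.3, §3.4] -/
theorem exists_rootPinned_realising_ideles_pilotDataOfK :
    ∃ (tq : ∀ (pp : Nat.Primes) (x : (thetaIndex (pilotDataOfK D K)).Fibre (.inr pp)),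
        haveI : Fact (pp : ℕ).Prime := ⟨pp.2⟩; kOf (pilotDataOfK D K) pp.1 x)
      (t : ∀ (pp : Nat.Primes) (_ : Fin (pilotDataOfK D K).lstar) (x : (thetaIndex (pilotDataOfK D K)).Fibre (.inr pp)),
        haveI : Fact (pp : ℕ).Prime := ⟨pp.2⟩; kOf (pilotDataOfK D K) pp.1 x),
      (∀ pp x, tq pp x ≠ 0) ∧
      (∀ (pp : Nat.Primes) (x : (thetaIndex (pilotDataOfK D K)).Fibre (.inr pp)),
          haveI : Fact (pp : ℕ).Prime := ⟨pp.2⟩; placeOf (pilotDataOfK D K) pp.1 x ∉ (pilotDataOfK D K).S → ‖tq pp x‖ = 1) ∧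
      (∀ (pp : Nat.Primes) (x : (thetaIndex (pilotDataOfK D K)).Fibre (.inr pp)),
          haveI : Fact (pp : ℕ).Prime := ⟨pp.2⟩
          Real.log ‖tq pp x‖ = -((pilotDataOfK D K).qPilot (placeOf (pilotDataOfK D K) pp.1 x)) *
            logNorm K (placeOf (pilotDataOfK D K) pp.1 x) / localDegree K (placeOf (pilotDataOfK D K) pp.1 x)) ∧
      (∀ (pp : Nat.Primes) (x : (thetaIndex (pilotDataOfK D K)).Fibre (.inr pp)),
          haveI : Fact (pp : ℕ).Prime := ⟨pp.2⟩
          placeOf (pilotDataOfK D K) pp.1 x ∈ (pilotDataOfK D K).S →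
            ∃ q : (placeOf (pilotDataOfK D K) pp.1 x).adicCompletion K,
              q ≠ 0 ∧ ‖q‖ < 1 ∧
              tateJ q = algebraMap K ((placeOf (pilotDataOfK D K) pp.1 x).adicCompletion K) (E.baseChange K).j ∧
              tq pp x ^ (2 * l) =
                RescaledCompletion.of K pp.1 (placeOf (pilotDataOfK D K) pp.1 x)
                  (natCast_mem_placeOf (pilotDataOfK D K) pp.1 x) q) ∧
      (∀ pp i x, t pp i x = tq pp x ^ (((i : ℕ) + 1) ^ 2)) ∧
      (∀ pp i x, t pp i x ≠ 0) ∧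
      (∀ (pp : Nat.Primes) (i : Fin (pilotDataOfK D K).lstar) (x : (thetaIndex (pilotDataOfK D K)).Fibre (.inr pp)),
          haveI : Fact (pp : ℕ).Prime := ⟨pp.2⟩; placeOf (pilotDataOfK D K) pp.1 x ∉ (pilotDataOfK D K).S → ‖t pp i x‖ = 1) ∧
      (∀ (pp : Nat.Primes) (i : Fin (pilotDataOfK D K).lstar) (x : (thetaIndex (pilotDataOfK D K)).Fibre (.inr pp)),
          haveI : Fact (pp : ℕ).Prime := ⟨pp.2⟩
          Real.log ‖t pp i x‖ = -((pilotDataOfK D K).thetaPilot i (placeOf (pilotDataOfK D K) pp.1 x)) *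
            logNorm K (placeOf (pilotDataOfK D K) pp.1 x) / localDegree K (placeOf (pilotDataOfK D K) pp.1 x)) := by
  obtain ⟨tq, h0, h1, h2, h3⟩ := exists_rootPinned_realising_qIdeles_pilotDataOfK D
  obtain ⟨ht0, ht1, ht⟩ := realising_thetaIdeles_of_qIdeles (pilotDataOfK D K) tq h0 h1 h2
  exact ⟨tq, fun pp i x => tq pp x ^ (((i : ℕ) + 1) ^ 2), h0, h1, h2, h3, fun _ _ _ => rfl, ht0, ht1, ht⟩

end Pair

/-! ## §5 (v2 append). Instance-free forms: the tower `F ⊆ K ⊆ F̄` is a FIELD of the Θ-datum (`D.isScalarTower`) -/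

section TowerFree

variable {F K Fbar : Type} [Field F] [NumberField F] [Field K] [NumberField K] [Algebra F K] [Field Fbar]
  [Algebra F Fbar] [Algebra K Fbar] {E : WeierstrassCurve F} [E.IsElliptic] {l : ℕ}
  {Pb : BadPlacePredicates K} (D : InitialThetaData F K Fbar E l Pb)

/-- **`exists_rootPinned_realising_qIdeles_pilotDataOfK` with NO extra instance binder** — the SAME binders as
`exists_realising_qIdeles_pilotDataOfK` (drop-in at every consumer, in particular under the `letI := T.inst…` preamble of the
certificates over `T : Cor22.ThetaVolumeDatumAt P l`, whose structure carries no tower instance): the compatibility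
`IsScalarTower F K F̄` demanded by abc-iut-L5-t12's Tate-parameter theorem is [IUTchI] Def. 3.1 (c) «`K ⊆ F̄`», a FIELD of the
typed datum (`InitialThetaData.isScalarTower`). [cite: Mochizuki2012, IUTchI Def. 3.1 (c) p. 61, Ex. 3.2 (iv) p. 71]
[cite: DupuyHilado2025, §3.4] -/
theorem exists_rootPinned_realising_qIdeles_pilotDataOfK' :
    ∃ tq : ∀ (pp : Nat.Primes) (x : (thetaIndex (pilotDataOfK D K)).Fibre (.inr pp)),
        haveI : Fact (pp : ℕ).Prime := ⟨pp.2⟩; kOf (pilotDataOfK D K) pp.1 x,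
      (∀ pp x, tq pp x ≠ 0) ∧
      (∀ (pp : Nat.Primes) (x : (thetaIndex (pilotDataOfK D K)).Fibre (.inr pp)),
          haveI : Fact (pp : ℕ).Prime := ⟨pp.2⟩; placeOf (pilotDataOfK D K) pp.1 x ∉ (pilotDataOfK D K).S → ‖tq pp x‖ = 1) ∧
      (∀ (pp : Nat.Primes) (x : (thetaIndex (pilotDataOfK D K)).Fibre (.inr pp)),
          haveI : Fact (pp : ℕ).Prime := ⟨pp.2⟩
          Real.log ‖tq pp x‖ = -((pilotDataOfK D K).qPilot (placeOf (pilotDataOfK D K) pp.1 x)) *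
            logNorm K (placeOf (pilotDataOfK D K) pp.1 x) / localDegree K (placeOf (pilotDataOfK D K) pp.1 x)) ∧
      (∀ (pp : Nat.Primes) (x : (thetaIndex (pilotDataOfK D K)).Fibre (.inr pp)),
          haveI : Fact (pp : ℕ).Prime := ⟨pp.2⟩
          placeOf (pilotDataOfK D K) pp.1 x ∈ (pilotDataOfK D K).S →
            ∃ q : (placeOf (pilotDataOfK D K) pp.1 x).adicCompletion K,
              q ≠ 0 ∧ ‖q‖ < 1 ∧
              tateJ q = algebraMap K ((placeOf (pilotDataOfK D K) pp.1 x).adicCompletion K) (E.baseChange K).j ∧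
              tq pp x ^ (2 * l) =
                RescaledCompletion.of K pp.1 (placeOf (pilotDataOfK D K) pp.1 x)
                  (natCast_mem_placeOf (pilotDataOfK D K) pp.1 x) q) := by
  haveI := D.isScalarTower
  exact exists_rootPinned_realising_qIdeles_pilotDataOfK D

/-- **`exists_rootPinned_realising_ideles_pilotDataOfK` with NO extra instance binder** (tower from `D.isScalarTower`): root-pinned
pairs `(t_q, t_Θ = t_q^{j²})` with all side conditions of `Thm311.Real.settingPrVolSharp (pilotDataOfK D K) …` and its certificates.
[cite: Mochizuki2012, IUTchI Def. 3.1 (c) p. 61, Ex. 3.2 (iv) p. 71] [cite: DupuyHilado2025, §3.3, §3.4] -/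
theorem exists_rootPinned_realising_ideles_pilotDataOfK' :
    ∃ (tq : ∀ (pp : Nat.Primes) (x : (thetaIndex (pilotDataOfK D K)).Fibre (.inr pp)),
        haveI : Fact (pp : ℕ).Prime := ⟨pp.2⟩; kOf (pilotDataOfK D K) pp.1 x)
      (t : ∀ (pp : Nat.Primes) (_ : Fin (pilotDataOfK D K).lstar) (x : (thetaIndex (pilotDataOfK D K)).Fibre (.inr pp)),
        haveI : Fact (pp : ℕ).Prime := ⟨pp.2⟩; kOf (pilotDataOfK D K) pp.1 x),
      (∀ pp x, tq pp x ≠ 0) ∧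
      (∀ (pp : Nat.Primes) (x : (thetaIndex (pilotDataOfK D K)).Fibre (.inr pp)),
          haveI : Fact (pp : ℕ).Prime := ⟨pp.2⟩; placeOf (pilotDataOfK D K) pp.1 x ∉ (pilotDataOfK D K).S → ‖tq pp x‖ = 1) ∧
      (∀ (pp : Nat.Primes) (x : (thetaIndex (pilotDataOfK D K)).Fibre (.inr pp)),
          haveI : Fact (pp : ℕ).Prime := ⟨pp.2⟩
          Real.log ‖tq pp x‖ = -((pilotDataOfK D K).qPilot (placeOf (pilotDataOfK D K) pp.1 x)) *
            logNorm K (placeOf (pilotDataOfK D K) pp.1 x) / localDegree K (placeOf (pilotDataOfK D K) pp.1 x)) ∧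
      (∀ (pp : Nat.Primes) (x : (thetaIndex (pilotDataOfK D K)).Fibre (.inr pp)),
          haveI : Fact (pp : ℕ).Prime := ⟨pp.2⟩
          placeOf (pilotDataOfK D K) pp.1 x ∈ (pilotDataOfK D K).S →
            ∃ q : (placeOf (pilotDataOfK D K) pp.1 x).adicCompletion K,
              q ≠ 0 ∧ ‖q‖ < 1 ∧
              tateJ q = algebraMap K ((placeOf (pilotDataOfK D K) pp.1 x).adicCompletion K) (E.baseChange K).j ∧
              tq pp x ^ (2 * l) =
                RescaledCompletion.of K pp.1 (placeOf (pilotDataOfK D K) pp.1 x)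
                  (natCast_mem_placeOf (pilotDataOfK D K) pp.1 x) q) ∧
      (∀ pp i x, t pp i x = tq pp x ^ (((i : ℕ) + 1) ^ 2)) ∧
      (∀ pp i x, t pp i x ≠ 0) ∧
      (∀ (pp : Nat.Primes) (i : Fin (pilotDataOfK D K).lstar) (x : (thetaIndex (pilotDataOfK D K)).Fibre (.inr pp)),
          haveI : Fact (pp : ℕ).Prime := ⟨pp.2⟩; placeOf (pilotDataOfK D K) pp.1 x ∉ (pilotDataOfK D K).S → ‖t pp i x‖ = 1) ∧
      (∀ (pp : Nat.Primes) (i : Fin (pilotDataOfK D K).lstar) (x : (thetaIndex (pilotDataOfK D K)).Fibre (.inr pp)),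
          haveI : Fact (pp : ℕ).Prime := ⟨pp.2⟩
          Real.log ‖t pp i x‖ = -((pilotDataOfK D K).thetaPilot i (placeOf (pilotDataOfK D K) pp.1 x)) *
            logNorm K (placeOf (pilotDataOfK D K) pp.1 x) / localDegree K (placeOf (pilotDataOfK D K) pp.1 x)) := by
  haveI := D.isScalarTower
  exact exists_rootPinned_realising_ideles_pilotDataOfK D

end TowerFree

end Summit.ABC.IUTFork.Cor312Prov

end
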